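import Mathlib
import Literature.Computability.AlgebraicComplexity.PIProof

/-!
# Route ProofCarryingSymmetry — item `StabilityOfProvableSymmetry` (stmt-ValiantsHypothesis-10358): what the hypothesis already gives

The item (the route's stability statement L) assumes, for a Hrubeš–Tzameret circuit `C` over the
matrix variables `x_ij` (`i, j < n`), `P_c`-proofs of the invariance identities `C∘τ = C` for the
ADJACENT transpositions `τ = (k k+1)` only.  This file records the two consequences every line of
attack on L starts from:

* `rename_smul_eq_of_mclosure_eq_top`, `rename_perm_eq_of_adjacent_swaps`: a polynomial invariant
  under a generating set of a monoid acting on the variables is invariant under the whole monoid;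
  in particular invariance under the adjacent transpositions of `Fin n` (diagonal action on
  `Fin n × Fin n`, or any action) is invariance under all of `S_n`
  (`Equiv.Perm.mclosure_swap_castSucc_succ`).
* `eval_rename_perm_eq_of_hasPCProofWithin_adjacent`: by SOUNDNESS of `P_c`
  (`HasPCProofWithin.eval_eq`, HT Prop. 1.1) the polynomial `Ĉ` of such a circuit is
  `S_n`-invariant — the standing hypothesis of every symmetric-circuit statement of the route
  (`RestorationQP`, Dawar–Wilsenach).
* `size_add_size_le_of_hasPCProofWithin`: a proof of `F = G` contains the line `F = G`, so its
  size is at least `|F| + |G|`; hence the proof-size parameter `t` of L dominates `2 · |C|`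
  (`two_mul_size_le_of_hasPCProofOfSize_rename`), i.e. the bound `(s + t + n + 2)^c` of L is a
  bound polynomial in `t` and `n` alone.
-/

noncomputable section

namespace Summit.ValiantsHypothesis.Theorems

open MvPolynomial Literature.Computability.AlgebraicComplexity

namespace ProofCarryingSymmetry

universe u v w

/-! ### Invariance under generators is invariance under the monoid -/

/-- If a polynomial is invariant under the relabelling of its variables by every element of a
generating set `S` of a monoid `M` acting on the variables, it is invariant under every element
of `M`. [folklore] -/
theorem rename_smul_eq_of_mclosure_eq_top {M : Type u} {X : Type v} {R : Type w} [Monoid M]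
    [MulAction M X] [CommSemiring R] (S : Set M) (hS : Submonoid.closure S = ⊤)
    (p : MvPolynomial X R) (h : ∀ g ∈ S, rename (fun x : X => g • x) p = p) (m : M) :
    rename (fun x : X => m • x) p = p := by
  let H : Submonoid M :=
    { carrier := {m | rename (fun x : X => m • x) p = p}
      one_mem' := by
        show rename (fun x : X => (1 : M) • x) p = p
        simp only [one_smul]
        exact rename_id_apply p
      mul_mem' := by
        intro a b ha hb
        show rename (fun x : X => (a * b) • x) p = p
        have hcomp : (fun x : X => (a * b) • x) = (fun x : X => a • x) ∘ (fun x : X => b • x) := by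
          funext x; simp [mul_smul]
        rw [hcomp, ← rename_rename, hb, ha] }
  have hle : Submonoid.closure S ≤ H := Submonoid.closure_le.2 fun g hg => h g hg
  have hm : m ∈ H := by
    apply hle
    rw [hS]
    exact Submonoid.mem_top m
  exact hm

/-- Invariance of a polynomial under the adjacent transpositions `(i i+1)` of `Fin (m+1)`
(acting on the variables through any action of `S_{m+1}`) is invariance under all of `S_{m+1}`:
the adjacent transpositions generate the symmetric group. [folklore] -/
theorem rename_perm_eq_of_adjacent_swaps_succ {m : ℕ} {X : Type v} {R : Type w}
    [MulAction (Equiv.Perm (Fin (m + 1))) X] [CommSemiring R] (p : MvPolynomial X R)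
    (h : ∀ i : Fin m, rename (fun x : X => Equiv.swap i.castSucc i.succ • x) p = p)
    (σ : Equiv.Perm (Fin (m + 1))) : rename (fun x : X => σ • x) p = p := by
  refine rename_smul_eq_of_mclosure_eq_top _ (Equiv.Perm.mclosure_swap_castSucc_succ m) p ?_ σ
  rintro _ ⟨i, rfl⟩
  exact h i

/-- Invariance of a polynomial under the adjacent transpositions `(i j)`, `j = i + 1`, of `Fin n`
(any `n`, any action of `S_n` on the variables — e.g. the diagonal relabelling
`x_ab ↦ x_{σ a, σ b}` of the route) is invariance under all of `S_n`. [folklore] -/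
theorem rename_perm_eq_of_adjacent_swaps {n : ℕ} {X : Type v} {R : Type w}
    [MulAction (Equiv.Perm (Fin n)) X] [CommSemiring R] (p : MvPolynomial X R)
    (h : ∀ i j : Fin n, (j : ℕ) = i + 1 → rename (fun x : X => Equiv.swap i j • x) p = p)
    (σ : Equiv.Perm (Fin n)) : rename (fun x : X => σ • x) p = p := by
  cases n with
  | zero =>
    have hσ : σ = 1 := Subsingleton.elim _ _
    subst hσ
    simp only [one_smul]
    exact rename_id_apply p
  | succ m =>
    exact rename_perm_eq_of_adjacent_swaps_succ p (fun i => h i.castSucc i.succ (by simp)) σ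

/-! ### Soundness: provable invariance identities make `Ĉ` invariant -/

/-- **What the hypothesis of L gives for free.** If for every adjacent transposition `τ = (i i+1)`
of `Fin n` the invariance identity `C∘τ = C` of a Hrubeš–Tzameret circuit `C` over the matrix
variables (relabelled diagonally, `x_ab ↦ x_{τ a, τ b}`) has a `P_c`-proof (of any size, within
any axiom budget), then the polynomial `Ĉ` is invariant under the diagonal action of all of
`S_n` — by soundness of `P_c` (HT Prop. 1.1) and generation of `S_n` by adjacent transpositions.
[folklore] -/
theorem eval_rename_perm_eq_of_hasPCProofWithin_adjacent {𝔽 : Type u} [CommSemiring 𝔽] {n : ℕ}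
    (C : PICircuit 𝔽 (Fin n × Fin n))
    (h : ∀ i j : Fin n, (j : ℕ) = i + 1 → ∃ (size : ℕ∞) (budget : PIAxiom → ℕ∞),
      HasPCProofWithin (C.rename fun x : Fin n × Fin n => Equiv.swap i j • x) C size budget)
    (σ : Equiv.Perm (Fin n)) :
    rename (fun x : Fin n × Fin n => σ • x) C.eval = C.eval := by
  refine rename_perm_eq_of_adjacent_swaps C.eval (fun i j hij => ?_) σ
  obtain ⟨size, budget, hπ⟩ := h i j hij
  have := hπ.eval_eq
  rwa [PICircuit.eval_rename] at this

/-- The same from size-bounded proofs (`HasPCProofOfSize`, the measure of the item).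
[folklore] -/
theorem eval_rename_perm_eq_of_hasPCProofOfSize_adjacent {𝔽 : Type u} [CommSemiring 𝔽] {n : ℕ}
    (C : PICircuit 𝔽 (Fin n × Fin n)) (t : ℕ)
    (h : ∀ i j : Fin n, (j : ℕ) = i + 1 →
      HasPCProofOfSize (C.rename fun x : Fin n × Fin n => Equiv.swap i j • x) C t)
    (σ : Equiv.Perm (Fin n)) :
    rename (fun x : Fin n × Fin n => σ • x) C.eval = C.eval :=
  eval_rename_perm_eq_of_hasPCProofWithin_adjacent C (fun i j hij => ⟨_, _, h i j hij⟩) σ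

/-! ### The proof-size parameter dominates the circuit size -/

/-- A proof of `F = G` within size `size` contains the line `F = G` itself, so
`|F| + |G| ≤ size`. [folklore] -/
theorem size_add_size_le_of_hasPCProofWithin {𝔽 : Type u} [CommSemiring 𝔽] {X : Type v}
    {F G : PICircuit 𝔽 X} {size : ℕ∞} {budget : PIAxiom → ℕ∞}
    (h : HasPCProofWithin F G size budget) : ((F.size + G.size : ℕ) : ℕ∞) ≤ size := by
  obtain ⟨Γ, π, hπ, -⟩ := h
  refine le_trans ?_ hπ
  exact_mod_cast π.size_add_size_le_size List.mem_cons_self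

/-- In particular a size-`t` proof of an invariance identity `C∘τ = C` forces `2 · |C| ≤ t`
(renaming preserves the size): the bound `(s + t + n + 2)^c` of L, `s = |C|`, is polynomial in
`t` and `n` alone. [folklore] -/
theorem two_mul_size_le_of_hasPCProofOfSize_rename {𝔽 : Type u} [CommSemiring 𝔽] {X : Type v}
    (f : X → X) {C : PICircuit 𝔽 X} {t : ℕ} (h : HasPCProofOfSize (C.rename f) C t) :
    2 * C.size ≤ t := by
  have := size_add_size_le_of_hasPCProofWithin h
  rw [PICircuit.size_rename] at this
  have h' : C.size + C.size ≤ t := by exact_mod_cast this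
  omega

end ProofCarryingSymmetry

end Summit.ValiantsHypothesis.Theorems
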